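/-
Copyright (c) 2026 the pub-hodgecm-mathlib formalisation cell (harness21).  Prover seat hodgecm-mathlib-F0P3a-p01 (g20), 2026-09-02.
-/
import Literature.LinearAlgebra.Matrix.SpecialLinearGroupTransvections     -- `SL(ι, F)` is generated by transvections (this seat, same day)
import Literature.NumberTheory.LocalFields.GLnCompactSubgroupsGenerate       -- ★ p850404: `exists_isCompact_isOpen_subgroup_transvection_mem`, `glInt`, `glDiagonal`
import HarnessLib

/-!
# Over a non-archimedean local field, `SL_n(F)` — indeed every `g ∈ GL_n(F)` with `det g ∈ 𝒪_Fˣ` — lies in the subgroup generated by the compact subgroups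

Topic `NumberTheory/LocalFields`; namespace `Literature.NumberTheory.LocalFields`.  THEOREMS ONLY (no `def`, no instance, no notation, no named fact, no `sorry`).
The rank-`n` form of ★ F0P3a-p03 (g21)'s `UnitaryGroupRankTwoNormOneGeneration` §2 `GL2.mem_closure_isCompact_of_det_eq_one` (`n = 2`, ★ Dickson): with
`SL(ι, F) = ⟨transvections⟩` for every finite `ι` (★ `Literature.LinearAlgebra.Matrix.transvection_induction`, Bourbaki A.III §8 no. 9 Prop. 17) and
«every transvection of `GL_n(F)` lies in a compact open subgroup» (★ `exists_isCompact_isOpen_subgroup_transvection_mem`, p850404),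

* **`mem_closure_isCompact_of_det_eq_one`** — `det g = 1 ⇒ g ∈ Subgroup.closure (⋃ K ∈ {K : Subgroup (GL (Fin n) F) | IsCompact ↑K}, ↑K)`, every `n`;
* **`mem_closure_isCompact_of_det_mem_integer`** — `det g ∈ 𝒪_F` and `(det g)⁻¹ ∈ 𝒪_F` ⇒ the same (`g = (g d⁻¹) · d`, `d = diag(det g, 1, …, 1) ∈ GL_n(𝒪_F)`, which
  is compact ★ `isCompact_glInt`);

in the `hg`∕`hgen` currency of ★ `IrrClass.apply_eq_smul_of_forall_isConstituentOf_eq_of_mem_closure` (p850252).  (The reverse inclusion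
«`⟨compact subgroups⟩ ≤ {det ∈ 𝒪ˣ}`», i.e. continuous characters of compact groups into the discrete value group are trivial, is NOT here.)

Cell `pub/hodgecm-mathlib`, h413 = `stmt-HodgeConjecture-24833` (consumer class: split-place isotypy ∕ strong-approximation words in any rank, e.g. `U(3)` at a
split place `= GL₃`).  HONEST LABEL: count-neutral; HC_CM is proved only modulo the printed citations of that programme until its rung 0 closes.

## References
* [BourbakiAlgebraI1989] N. Bourbaki, *Algebra I, Chapters 1–3* (1989), Ch. III §8 no. 9 Prop. 17; held text `book:bourbakind-algebra`.
* [PlatonovRapinchuk1994] V. Platonov, A. Rapinchuk, *Algebraic Groups and Number Theory* (1994), §3.3 (compact open subgroups `GL_n(𝒪)` and conjugates).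
* [Serre1980Trees] J.-P. Serre, *Trees* (1980), Ch. II §1.2–§1.4 (`SL_2` over a local field and the subgroup generated by vertex stabilisers).
-/

set_option autoImplicit false

open Matrix ValuativeRel Topology
open scoped MatrixGroups
open Literature.NumberTheory.Automorphic Literature.LinearAlgebra.Matrix

namespace Literature.NumberTheory.LocalFields

universe u

variable {F : Type u} [Field F] [ValuativeRel F] [TopologicalSpace F] [IsNonarchimedeanLocalField F]

/-- **`SL_n(F) ≤ ⟨compact subgroups of GL_n(F)⟩` over a non-archimedean local field, every `n`**: an invertible matrix of determinant `1` is a word in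
transvection units (★ `generalLinearGroup_mem_of_forall_transvection_mem_of_det_eq_one`), each of which lies in a compact (open) subgroup
(★ `exists_isCompact_isOpen_subgroup_transvection_mem`). [cite: Serre1980Trees, Ch. II §1.4] [cite: PlatonovRapinchuk1994, §3.3]
[cite: BourbakiAlgebraI1989, Ch. III §8 no. 9 Prop. 17] -/
theorem mem_closure_isCompact_of_det_eq_one (n : ℕ) (g : GL (Fin n) F) (hg : (g : Matrix (Fin n) (Fin n) F).det = 1) :
    g ∈ Subgroup.closure (⋃ K ∈ {K : Subgroup (GL (Fin n) F) | IsCompact (K : Set (GL (Fin n) F))}, (K : Set (GL (Fin n) F))) := by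
  refine generalLinearGroup_mem_of_forall_transvection_mem_of_det_eq_one _ (fun t => ?_) g hg
  obtain ⟨K, hKc, -, htK⟩ := exists_isCompact_isOpen_subgroup_transvection_mem (F := F) t
  exact Subgroup.subset_closure (Set.mem_iUnion₂.2 ⟨K, hKc, htK⟩)

/-- Consumer form: **a subgroup of `GL_n(F)` containing every compact subgroup contains `SL_n(F)`.** [cite: Serre1980Trees, Ch. II §1.4]
[cite: PlatonovRapinchuk1994, §3.3] -/
theorem mem_of_forall_isCompact_le_of_det_eq_one (n : ℕ) (H : Subgroup (GL (Fin n) F))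
    (hK : ∀ K : Subgroup (GL (Fin n) F), IsCompact (K : Set (GL (Fin n) F)) → K ≤ H) (g : GL (Fin n) F)
    (hg : (g : Matrix (Fin n) (Fin n) F).det = 1) : g ∈ H := by
  refine (Subgroup.closure_le H).2 ?_ (mem_closure_isCompact_of_det_eq_one n g hg)
  intro x hx
  obtain ⟨K, hK', hxK⟩ := Set.mem_iUnion₂.1 hx
  exact hK K hK' hxK

omit [TopologicalSpace F] [IsNonarchimedeanLocalField F] in
/-- **`diag(u, 1, …, 1) ∈ GL_{n+1}(𝒪_F)` for `u, u⁻¹ ∈ 𝒪_F`.** [cite: PlatonovRapinchuk1994, §3.3] -/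
theorem glDiagonal_update_zero_mem_glInt (n : ℕ) (u : Fˣ) (hu : (u : F) ∈ 𝒪[F]) (hu' : ((u⁻¹ : Fˣ) : F) ∈ 𝒪[F]) :
    glDiagonal (n + 1) F (Function.update (1 : Fin (n + 1) → Fˣ) 0 u) ∈ glInt (n + 1) F := by
  rw [mem_glInt_iff, ← map_inv, coe_glDiagonal, coe_glDiagonal]
  refine ⟨fun i j => ?_, fun i j => ?_⟩
  · rw [Matrix.diagonal_apply]
    split_ifs with h
    · by_cases hi : i = 0
      · subst hi
        rwa [Function.update_self]
      · rw [Function.update_of_ne hi, Pi.one_apply, Units.val_one]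
        exact one_mem _
    · exact zero_mem _
  · rw [Matrix.diagonal_apply]
    split_ifs with h
    · by_cases hi : i = 0
      · subst hi
        rwa [Pi.inv_apply, Function.update_self]
      · rw [Pi.inv_apply, Function.update_of_ne hi, Pi.one_apply, inv_one, Units.val_one]
        exact one_mem _
    · exact zero_mem _

/-- **`{g ∈ GL_n(F) | det g ∈ 𝒪_Fˣ} ≤ ⟨compact subgroups⟩`**: if `det g` and `(det g)⁻¹` are integral then `g = (g · d⁻¹) · d` with
`d = diag(det g, 1, …, 1) ∈ GL_n(𝒪_F)` (compact, ★ `isCompact_glInt`) and `det (g d⁻¹) = 1` (previous theorem).  For `n = 0` every `g` is `1`.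
[cite: Serre1980Trees, Ch. II §1.4] [cite: PlatonovRapinchuk1994, §3.3] -/
theorem mem_closure_isCompact_of_det_mem_integer (n : ℕ) (g : GL (Fin n) F) (hg : (g : Matrix (Fin n) (Fin n) F).det ∈ 𝒪[F])
    (hg' : ((g : Matrix (Fin n) (Fin n) F).det)⁻¹ ∈ 𝒪[F]) :
    g ∈ Subgroup.closure (⋃ K ∈ {K : Subgroup (GL (Fin n) F) | IsCompact (K : Set (GL (Fin n) F))}, (K : Set (GL (Fin n) F))) := by
  cases n with
  | zero =>
    -- `GL_0` is trivial
    have h1 : g = 1 := Subsingleton.elim _ _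
    rw [h1]
    exact one_mem _
  | succ n =>
    have hdet : (g : Matrix (Fin (n + 1)) (Fin (n + 1)) F).det ≠ 0 := Matrix.GeneralLinearGroup.det_ne_zero g
    set d : GL (Fin (n + 1)) F := glDiagonal (n + 1) F (Function.update (1 : Fin (n + 1) → Fˣ) 0 (Units.mk0 _ hdet)) with hd
    have hdmem : d ∈ Subgroup.closure (⋃ K ∈ {K : Subgroup (GL (Fin (n + 1)) F) | IsCompact (K : Set (GL (Fin (n + 1)) F))},
        (K : Set (GL (Fin (n + 1)) F))) :=
      Subgroup.subset_closure (Set.mem_iUnion₂.2 ⟨glInt (n + 1) F, isCompact_glInt (n + 1) F,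
        glDiagonal_update_zero_mem_glInt n (Units.mk0 _ hdet) hg (by rwa [Units.val_inv_eq_inv_val, Units.val_mk0])⟩)
    have hdetd : (d : Matrix (Fin (n + 1)) (Fin (n + 1)) F).det = (g : Matrix (Fin (n + 1)) (Fin (n + 1)) F).det := by
      rw [hd, coe_glDiagonal, Matrix.det_diagonal, Fin.prod_univ_succ, Function.update_self, Units.val_mk0]
      rw [Finset.prod_eq_one fun i _ => ?_, mul_one]
      rw [Function.update_of_ne (Fin.succ_ne_zero i), Pi.one_apply, Units.val_one]
    have h1 : ((g * d⁻¹ : GL (Fin (n + 1)) F) : Matrix (Fin (n + 1)) (Fin (n + 1)) F).det = 1 := by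
      rw [Units.val_mul, Matrix.det_mul, Matrix.coe_units_inv, Matrix.det_nonsing_inv, hdetd, Ring.mul_inverse_cancel _ (Ne.isUnit hdet)]
    have key := mul_mem (mem_closure_isCompact_of_det_eq_one (n + 1) (g * d⁻¹) h1) hdmem
    rwa [inv_mul_cancel_right] at key

end Literature.NumberTheory.LocalFields
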